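import Mathlib
import Literature.MathematicalPhysics.QuantumFieldTheory.Balaban1983to89.B10LargeField

/-!
# `Balaban1983to89.B10LargeFieldSum` — [Balaban1985UV3] (T. Bałaban, *Ultraviolet stability of three-dimensional lattice
# pure gauge field theories*, CMP **102**, 255–275 (1985); cell paper B10): the SUM over large-field histories in the
# inductive bound (41) — a refined history carrier over `B10.TowerRun`, the verbatim leaves (67)–(71) "for all
# plaquettes in all large fields set P" (p. 273) and the rate of the volume terms of (41)/(66), and a KERNEL proof, in
# the per-plaquette organisation, that they give `B10.LargeFieldControlPrinted` under explicit exponent provisos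

CITATION HEADER (lean-in-tree rule 2026-08-18; audit cell `pub-balaban`, PAPER SUB-CELL B10, gen 3, unit
`b2b-balaban-b10-g3`; v1.1 = gen 4 DOCFIX, unit `b2b-balaban-b10-g4`: four quotations re-typed verbatim from the page
renders after the cell's cross-read — (7) p. 257, the resummation sentence pp. 257–258, the |T₁^{(k)}| display p. 256,
and (64)–(66) placed on p. 273 [19]; no declaration, hypothesis or cite key changed).  A SIBLING module of `…Balaban1983to89.B10` (gen 1: Theorems 1, 2, the tower carrier `TowerRun`,
(41), (47), Sect. D bookkeeping, the leaf `LargeFieldControlPrinted`) and of `…Balaban1983to89.B10LargeField` (gen 2: the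
geometric setting (38)–(40), the p. 268 rule, the per-plaquette exponent balance); it imports the latter and modifies
neither.  PDF held: `paper:balaban1985-cmp102-uv-stability-3d` (journal page = PDF page + 254; page renders re-opened for
every quotation below: pp. 256, 257, 258, 265, 266, 267, 268, 273, 274).

WHAT IS REPRODUCED (statement level, verbatim in the docstrings, journal page [PDF page]):
* p. 257 [3] (7) and p. 258 [4] (8): the decomposition of unity into small/large-field plaquette sets `P` and the
  *"partial resummation over all P determining the same domain Ω₁"*; p. 266 [12] (41): the sum *"Σ_{{Ω_j}} ∫dV_{k−1}↾Z_{k−1}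
  ⋯"* over large-field histories with the volume terms *"Σ_{j=0}^{k−1} O(log g_j⁻¹)|Z_j|"*; p. 267 [13] – p. 268 [14]: the
  decomposition *"for the field V on the domain Λ_k, with ε₁ = g_kp(g_k)"* and the rule for Ω_{k+1}; p. 256 [2]:
  *"|T₁^{(k)}| … = (Lᵏε)⁻³|T_ε|"* — gathered into ONE refined carrier `HistModel T` over gen 1's `B10.TowerRun`: the
  discrete large-field histories `{(j, p′) : p′ ∈ P_j, j < k}` as finite sets of (scale, plaquette) pairs drawn from a
  candidate set of ≤ 3|T₁^{(j)}| = 3e^{σ(k−j)}|T₁^{(k)}| plaquettes per scale (σ = 3 log L), the volumes |Z_j| per history,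
  and the DOMINATION inequality "functional ≤ Σ over histories of e^{sup of the exponent} × mass" that (41) is used through.
* p. 273 [19] (67)–(71) with the sentence *"We get these small factors for all plaquettes in all large fields set P"*:
  the leaf `SmallFactorsAll` — the main action dominates `c₁ · Σ_{(j,p′)} ¼p²(g_j)` over the plaquettes of the history
  (print: c₁ = 1, the regions Δ′(p′) treated as disjoint; the overlap constant is made explicit, cell GAPS G-B10-10).
* p. 266 [12] (41) / p. 273 [19] (66): the rate of the volume terms, leaf `ZtermRate` (`O(log g_j⁻¹) ≤ A·(1 + log g_j⁻¹)`).
* pp. 267–268 rule + (39): the COUNTED collar cover `ZvolCover` — |Z_j| of a history is at most the sum over its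
  plaquettes (i, p′), i ≤ j, of (c_g R₁M₁ x_i^{r₀})³; its set-theoretic half (every point of Z_j lies within the
  accumulated collar widths of some plaquette of P_i, i ≤ j, under the maximal reading of the rule) is PROVED here over an
  abstract pseudometric carrier (`CollarChain`, `cover_chain`); the lattice ball count is not modelled (as for [9] (3.50) in
  `…B2Sect3C`, cell DIVERGENCE D-b10.7).

WHAT IS PROVED (kernel; re-derived bookkeeping in the paper's own variables, no content of the series asserted):
* the RESUMMATION identity behind "control all sums in (41)" in the per-plaquette organisation:
  `Σ_{Q ⊆ E} Π_{e∈Q} w_e = Π_{e∈E} (1 + w_e) ≤ exp Σ_{e∈E} w_e` (`sum_powerset_prod_le_exp`, `sum_powerset_exp_sum_le`) — the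
  "repair the referee can see" recorded for the unprinted step (3.46) ⇒ (3.47) of [9] (cell GAPS G-pv04-3), here for B10;
* the exchange "Σ over scales of Σ over sources = Σ over sources of Σ over later scales" (`exchange_sum`), the per-source
  penalty `Σ_{i≤j<k} (A x_j + A₀)(c_gρ)³x_i^{3r₀} ≤ ((A+A₀)(c_gρ)³/ℓ)·x_i^{3r₀+2}` along B10's progression
  `x_j = x_K + (K − j)ℓ`, ℓ = ½ log L (`scaleSum_le`, `perSource_net_le`; gen 2's `balance_of_large_b₀` shape with the
  overlap constant: `balance_c₁`), and the scale entropy sum `Σ_{j<k} 3e^{σ(k−j)}|T₁^{(k)}| e^{−κx_j} ≤ 3|T₁^{(k)}|/ℓ` once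
  `κℓ ≥ σ + ℓ` (`geomTail_le`, `expTail_le`, `scaleEntropy_sum_le`) — the d = 3 mechanism: the running `p(g_j)` grows
  linearly DOWN the scales and beats the site entropy `L^{3(k−j)}`;
* MAIN: `largeFieldControl_of_resummation` — the three leaves + `0 < g_j ≤ g̃ ≤ 1` + the progression give gen 1's
  `B10.LargeFieldControlPrinted T` with `d = 3/ℓ`, PROVIDED `3r₀ + 2 ≤ 2p₀`, `c₁b₀² ≥ 8(A + A₀)(c_gR₁M₁)³/ℓ` and
  `c₁b₀²ℓ ≥ 8(σ + ℓ)` (= `c₁b₀² ≥ 56` at σ = 3 log L: `largeFieldControl_of_resummation_gRun`, stated on the printed flow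
  `g_j = g(Lʲε)^{1/2}`).  The first proviso is the cell's located objection G-adv2-7 / G-B10-02 (print: "p₀ > 2", r₀ free);
  the b₀-conditions read p. 257 [3] *"b₀ is a sufficiently large absolute constant"* (they involve L, M₁, R₁ and the O(1)
  of (41): cell GAPS G-B10-10).

WHAT IS NOT HERE.  The production of the small factors (67)–(71) themselves (Sect. C–D analysis; leaf), the O(1) of the
volume terms (leaf), the construction of the carrier from the actual integrals (the carrier only NAMES (41)'s objects),
[9]'s own cube/corridor organisation (`…B2Sect3C`, leaves `Leaf347`/`Bound350` untouched).  Value = typed skeleton + one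
located gap closed in the kernel MODULO verbatim leaves, NOT summit progress; d = 3 throughout (cell DIVERGENCE D-r2.1).
-/

namespace Literature.MathematicalPhysics.QuantumFieldTheory.Balaban1983to89.B10LargeFieldSum

open Literature.MathematicalPhysics.QuantumFieldTheory.Balaban1983to89
open B10LargeField

/-! ## 1. The resummation identity (abstract) -/

section Resummation

variable {ι : Type*}

/-- **The {P_j}-resummation in the per-plaquette organisation.**  For nonnegative weights on a finite candidate set E,
the sum over ALL sub-families Q ⊆ E of the products of weights is `Π_{e∈E}(1 + w_e) ≤ exp Σ_{e∈E} w_e`.  This is the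
counting device by which "small factors per large-field plaquette" control a sum over large-field histories: pp. 257–258
[3–4] *"Now we perform a partial resummation over all P determining the same domain Ω₁, and we write the decomposition
(7) as 1 = Σ_{admissible Ω₁} ζ_{Ω₁ᶜ}χ_{Ω₁}, (8)"*, pp. 273–274 [19–20] *"these small factors are enough to control all
sums in (41)"*.  Supplied proof (the print delegates the step to [9] Sect. 3.C, whose
organisation is by cubes and corridors; cell GAPS G-pv04-3 records the same device as the repair of [9]'s unprinted
(3.46) ⇒ (3.47)). [folklore: `Finset.prod_one_add`, `Real.add_one_le_exp`; cite: Balaban1985UV3, (8) p.258, pp.273–274] -/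
theorem sum_powerset_prod_le_exp (E : Finset ι) (w : ι → ℝ) (hw : ∀ e ∈ E, 0 ≤ w e) :
    ∑ Q ∈ E.powerset, ∏ e ∈ Q, w e ≤ Real.exp (∑ e ∈ E, w e) := by
  rw [← Finset.prod_one_add, Real.exp_sum]
  exact Finset.prod_le_prod (fun e he => by linarith [hw e he]) fun e _ => by
    linarith [Real.add_one_le_exp (w e)]

/-- Additive form: if the exponent of the history Q is a sum of per-plaquette contributions θ_e, e ∈ Q, then
`Σ_{Q⊆E} exp(Σ_{e∈Q} θ_e) ≤ exp(Σ_{e∈E} e^{θ_e})`. [folklore: additive form of the previous identity; cite: Balaban1985UV3, pp.273–274] -/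
theorem sum_powerset_exp_sum_le (E : Finset ι) (θ : ι → ℝ) :
    ∑ Q ∈ E.powerset, Real.exp (∑ e ∈ Q, θ e) ≤ Real.exp (∑ e ∈ E, Real.exp (θ e)) := by
  have h : ∀ Q ∈ E.powerset, Real.exp (∑ e ∈ Q, θ e) = ∏ e ∈ Q, Real.exp (θ e) :=
    fun Q _ => Real.exp_sum Q θ
  rw [Finset.sum_congr rfl h]
  exact sum_powerset_prod_le_exp E (fun e => Real.exp (θ e)) fun e _ => (Real.exp_pos _).le

/-- Exchange of the two finite sums of the volume penalty: Σ over scales j < k of (rate at j) × (Σ over the sources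
(i, p′) with i ≤ j of their collar volume) = Σ over sources of (collar volume) × (Σ of the rates over the scales
j ∈ [i, k)). [folklore] -/
theorem exchange_sum {β : Type*} (Q : Finset (ℕ × β)) (k : ℕ) (f : ℕ → ℝ) (V : ℕ × β → ℝ) :
    ∑ j ∈ Finset.range k, f j * ∑ e ∈ Q.filter (fun e => e.1 ≤ j), V e
      = ∑ e ∈ Q, V e * ∑ j ∈ (Finset.range k).filter (fun j => e.1 ≤ j), f j := by
  simp only [Finset.sum_filter, Finset.mul_sum]
  rw [Finset.sum_comm]
  refine Finset.sum_congr rfl fun e _ => Finset.sum_congr rfl fun j _ => ?_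
  by_cases h : e.1 ≤ j <;> simp [h, mul_comm]

end Resummation

/-! ## 2. B10's numbers along the flow `x_j = x_K + (K − j)ℓ`, ℓ = ½ log L -/

section Numbers

/-- Gen 2's `B10LargeField.balance_of_large_b₀` with the overlap constant c₁ of the small factors carried along:
`x ≥ 1`, `q ≤ 2p₀`, `8D ≤ c₁b₀²` give `D·x^q ≤ c₁(b₀x^{p₀})²/8`. [folklore: real arithmetic; cite: Balaban1985UV3, (7) p.257] -/
theorem balance_c₁ {D c₁ b₀ p₀ q x : ℝ} (hx : 1 ≤ x) (hq : q ≤ 2 * p₀) (hD : 0 ≤ D)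
    (hb : 8 * D ≤ c₁ * b₀ ^ 2) : D * x ^ q ≤ c₁ * (b₀ * x ^ p₀) ^ 2 / 8 := by
  have hx0 : 0 < x := by linarith
  have h1 : x ^ q ≤ x ^ (2 * p₀) := Real.rpow_le_rpow_of_exponent_le hx hq
  have h2 : x ^ (2 * p₀) = (x ^ p₀) ^ 2 := by rw [mul_comm, Real.rpow_mul hx0.le, Real.rpow_two]
  have h3 : 0 ≤ x ^ (2 * p₀) := Real.rpow_nonneg hx0.le _
  calc D * x ^ q ≤ D * x ^ (2 * p₀) := mul_le_mul_of_nonneg_left h1 hD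
    _ ≤ (c₁ * b₀ ^ 2 / 8) * x ^ (2 * p₀) := mul_le_mul_of_nonneg_right (by linarith) h3
    _ = c₁ * (b₀ * x ^ p₀) ^ 2 / 8 := by rw [mul_pow, ← h2]; ring

/-- The rates summed over the scales a source created at scale i lives through: with `x_j ≤ x_i` for `i ≤ j ≤ k`,
`x_j ≥ 1`, and `x_i − x_k = (k − i)ℓ` (B10's progression, `B10LargeField.xlog_gRun`),
`Σ_{i ≤ j < k} (A x_j + A₀) ≤ (A + A₀) x_i²/ℓ` — the number of scales `k − i ≤ x_i/ℓ` is paid by one power of x_i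
(gen 2's `penalty_le_B10count` mechanism). [cite: Balaban1985UV3, (41) p.266; (5) p.256] -/
theorem scaleSum_le {A A₀ ℓ : ℝ} {x : ℕ → ℝ} {i k : ℕ} (hA : 0 ≤ A) (hA₀ : 0 ≤ A₀) (hℓ : 0 < ℓ) (hik : i ≤ k)
    (hone : ∀ j, j ≤ k → 1 ≤ x j) (hmono : ∀ j, i ≤ j → j ≤ k → x j ≤ x i)
    (hdiff : x i - x k = ((k - i : ℕ) : ℝ) * ℓ) :
    ∑ j ∈ (Finset.range k).filter (fun j => i ≤ j), (A * x j + A₀) ≤ (A + A₀) * x i ^ 2 / ℓ := by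
  have hfilt : (Finset.range k).filter (fun j => i ≤ j) = Finset.Ico i k := by
    ext j
    simp [Finset.mem_Ico, and_comm]
  rw [hfilt]
  have hxi : 1 ≤ x i := hone i hik
  have hterm : ∀ j ∈ Finset.Ico i k, A * x j + A₀ ≤ (A + A₀) * x i := by
    intro j hj
    rw [Finset.mem_Ico] at hj
    have h1 := hmono j hj.1 hj.2.le
    have h2 := hone j hj.2.le
    nlinarith
  have hcard : ((Finset.Ico i k).card : ℝ) = ((k - i : ℕ) : ℝ) := by rw [Nat.card_Ico]
  have hki : ((k - i : ℕ) : ℝ) * ℓ ≤ x i := by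
    have := hone k le_rfl
    linarith [hdiff]
  have hki' : ((k - i : ℕ) : ℝ) ≤ x i / ℓ := (le_div_iff₀ hℓ).mpr hki
  calc ∑ j ∈ Finset.Ico i k, (A * x j + A₀) ≤ ∑ j ∈ Finset.Ico i k, (A + A₀) * x i := Finset.sum_le_sum hterm
    _ = ((k - i : ℕ) : ℝ) * ((A + A₀) * x i) := by rw [Finset.sum_const, nsmul_eq_mul, hcard]
    _ ≤ (x i / ℓ) * ((A + A₀) * x i) := mul_le_mul_of_nonneg_right hki' (by nlinarith)
    _ = (A + A₀) * x i ^ 2 / ℓ := by ring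

/-- **Per-source net exponent.**  A large-field plaquette created at scale i < k contributes the gain
`−c₁·¼p²(g_i) = −(c₁/4)(b₀x_i^{p₀})²` ((71) p. 273, overlap constant c₁) and, through the collars it forces in Z_j for
every j ∈ [i, k) (p. 268 rule, (39)), the penalty `(c_gρ)³x_i^{3r₀} · Σ_{i≤j<k}(A x_j + A₀)` (ρ = R₁M₁; rate of (41)
plus a mass allowance A₀).  If `3r₀ + 2 ≤ 2p₀` and `8(A + A₀)(c_gρ)³/ℓ ≤ c₁b₀²` the net is `≤ −(c₁/8)(b₀x_i^{p₀})²`: half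
the small factor survives for the resummation.  Re-derived; the proviso on the exponents is NOT printed (cell GAPS
G-adv2-7 / G-B10-02). [cite: Balaban1985UV3, (71) p.273, (41) p.266, (7) p.257] -/
theorem perSource_net_le {A A₀ c₁ b₀ p₀ r₀ cρ ℓ : ℝ} {x : ℕ → ℝ} {i k : ℕ}
    (hA : 0 ≤ A) (hA₀ : 0 ≤ A₀) (hc : 0 ≤ cρ) (hℓ : 0 < ℓ) (hik : i < k)
    (hone : ∀ j, j ≤ k → 1 ≤ x j) (hmono : ∀ j, i ≤ j → j ≤ k → x j ≤ x i)
    (hdiff : x i - x k = ((k - i : ℕ) : ℝ) * ℓ)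
    (hp : r₀ * 3 + 2 ≤ 2 * p₀) (hb : 8 * ((A + A₀) * cρ ^ 3 / ℓ) ≤ c₁ * b₀ ^ 2) :
    -(c₁ * (b₀ * x i ^ p₀) ^ 2 / 4)
      + cρ ^ 3 * x i ^ (3 * r₀) * ∑ j ∈ (Finset.range k).filter (fun j => i ≤ j), (A * x j + A₀)
      ≤ -(c₁ * (b₀ * x i ^ p₀) ^ 2 / 8) := by
  have hxi : 1 ≤ x i := hone i hik.le
  have hx0 : 0 < x i := by linarith
  have hS := scaleSum_le hA hA₀ hℓ hik.le hone hmono hdiff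
  have hpow : x i ^ (3 * r₀) * x i ^ 2 = x i ^ (r₀ * 3 + 2) := by
    rw [show r₀ * 3 + 2 = 3 * r₀ + 2 by ring, Real.rpow_add hx0, Real.rpow_two]
  have hD : 0 ≤ (A + A₀) * cρ ^ 3 / ℓ := by positivity
  have hpen : cρ ^ 3 * x i ^ (3 * r₀) * ∑ j ∈ (Finset.range k).filter (fun j => i ≤ j), (A * x j + A₀)
      ≤ ((A + A₀) * cρ ^ 3 / ℓ) * x i ^ (r₀ * 3 + 2) := by
    have h0 : 0 ≤ cρ ^ 3 * x i ^ (3 * r₀) := mul_nonneg (pow_nonneg hc 3) (Real.rpow_nonneg hx0.le _)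
    calc cρ ^ 3 * x i ^ (3 * r₀) * ∑ j ∈ (Finset.range k).filter (fun j => i ≤ j), (A * x j + A₀)
        ≤ cρ ^ 3 * x i ^ (3 * r₀) * ((A + A₀) * x i ^ 2 / ℓ) := mul_le_mul_of_nonneg_left hS h0
      _ = ((A + A₀) * cρ ^ 3 / ℓ) * (x i ^ (3 * r₀) * x i ^ 2) := by ring
      _ = ((A + A₀) * cρ ^ 3 / ℓ) * x i ^ (r₀ * 3 + 2) := by rw [hpow]
  have hbal := balance_c₁ hxi hp hD hb
  linarith

/-- `Σ_{j<k} r^{k−j} ≤ r/(1 − r)` for `0 ≤ r < 1`. [folklore] -/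
theorem geomTail_le {r : ℝ} (hr0 : 0 ≤ r) (hr1 : r < 1) (k : ℕ) :
    ∑ j ∈ Finset.range k, r ^ (k - j) ≤ r / (1 - r) := by
  induction k with
  | zero =>
    simp only [Finset.range_zero, Finset.sum_empty]
    exact div_nonneg hr0 (by linarith)
  | succ k ih =>
    rw [Finset.sum_range_succ, show k + 1 - k = 1 from by omega, pow_one]
    have h : ∑ j ∈ Finset.range k, r ^ (k + 1 - j) = (∑ j ∈ Finset.range k, r ^ (k - j)) * r := by
      rw [Finset.sum_mul]
      refine Finset.sum_congr rfl fun j hj => ?_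
      rw [Finset.mem_range] at hj
      rw [Nat.succ_sub hj.le, pow_succ]
    rw [h]
    have h1 : 1 - r ≠ 0 := ne_of_gt (by linarith)
    calc (∑ j ∈ Finset.range k, r ^ (k - j)) * r + r ≤ r / (1 - r) * r + r := by
          nlinarith [ih]
      _ = r / (1 - r) := by field_simp; ring

/-- `e^{−ℓ}/(1 − e^{−ℓ}) = 1/(e^{ℓ} − 1) ≤ 1/ℓ` for ℓ > 0. [folklore] -/
theorem expTail_le {ℓ : ℝ} (hℓ : 0 < ℓ) : Real.exp (-ℓ) / (1 - Real.exp (-ℓ)) ≤ 1 / ℓ := by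
  have hr1 : Real.exp (-ℓ) < 1 := Real.exp_lt_one_iff.mpr (by linarith)
  have h : Real.exp (-ℓ) * (ℓ + 1) ≤ 1 := by
    calc Real.exp (-ℓ) * (ℓ + 1) ≤ Real.exp (-ℓ) * Real.exp ℓ :=
          mul_le_mul_of_nonneg_left (by linarith [Real.add_one_le_exp ℓ]) (Real.exp_pos _).le
      _ = 1 := by rw [← Real.exp_add]; simp
  rw [div_le_div_iff₀ (by linarith) hℓ]
  nlinarith [h, Real.exp_pos (-ℓ)]

/-- **The scale entropy sum (d = 3 mechanism).**  With at most `3e^{σ(k−j)}S` candidate plaquettes at scale j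
(S = |T₁^{(k)}|, σ = 3 log L: p. 256 [2] *"|T₁^{(k)}| = (Lᵏε)⁻³|T_ε|"*) each carrying a surviving small factor
`e^{−κx_j}` with `x_j ≥ 1 + (k − j)ℓ`, the total is `≤ 3S/ℓ` as soon as `κℓ ≥ σ + ℓ`: the running `p(g_j)` beats the site
entropy because `log g_j⁻¹` grows linearly down the scales. [cite: Balaban1985UV3, (5) p.256, (71) p.273] -/
theorem scaleEntropy_sum_le {κ σ ℓ S : ℝ} (x : ℕ → ℝ) (k : ℕ) (hℓ : 0 < ℓ) (hS : 0 ≤ S) (hκ : 0 ≤ κ)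
    (hκℓ : σ + ℓ ≤ κ * ℓ) (hxj : ∀ j, j < k → 1 + ((k - j : ℕ) : ℝ) * ℓ ≤ x j) :
    ∑ j ∈ Finset.range k, 3 * Real.exp (σ * ((k - j : ℕ) : ℝ)) * S * Real.exp (-(κ * x j))
      ≤ 3 * S / ℓ := by
  have hr0 : 0 ≤ Real.exp (-ℓ) := (Real.exp_pos _).le
  have hr1 : Real.exp (-ℓ) < 1 := Real.exp_lt_one_iff.mpr (by linarith)
  have hterm : ∀ j ∈ Finset.range k,
      3 * Real.exp (σ * ((k - j : ℕ) : ℝ)) * S * Real.exp (-(κ * x j))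
        ≤ 3 * S * Real.exp (-ℓ) ^ (k - j) := by
    intro j hj
    rw [Finset.mem_range] at hj
    have hm : (0 : ℝ) ≤ ((k - j : ℕ) : ℝ) := Nat.cast_nonneg _
    have key : Real.exp (σ * ((k - j : ℕ) : ℝ)) * Real.exp (-(κ * x j)) ≤ Real.exp (-ℓ) ^ (k - j) := by
      rw [← Real.exp_nat_mul, ← Real.exp_add]
      apply Real.exp_le_exp.mpr
      have h1 : κ * (1 + ((k - j : ℕ) : ℝ) * ℓ) ≤ κ * x j := mul_le_mul_of_nonneg_left (hxj j hj) hκ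
      have h2 : (σ + ℓ) * ((k - j : ℕ) : ℝ) ≤ κ * ℓ * ((k - j : ℕ) : ℝ) :=
        mul_le_mul_of_nonneg_right hκℓ hm
      nlinarith
    calc 3 * Real.exp (σ * ((k - j : ℕ) : ℝ)) * S * Real.exp (-(κ * x j))
        = 3 * S * (Real.exp (σ * ((k - j : ℕ) : ℝ)) * Real.exp (-(κ * x j))) := by ring
      _ ≤ 3 * S * Real.exp (-ℓ) ^ (k - j) := mul_le_mul_of_nonneg_left key (by positivity)
  calc ∑ j ∈ Finset.range k, 3 * Real.exp (σ * ((k - j : ℕ) : ℝ)) * S * Real.exp (-(κ * x j))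
      ≤ ∑ j ∈ Finset.range k, 3 * S * Real.exp (-ℓ) ^ (k - j) := Finset.sum_le_sum hterm
    _ = 3 * S * ∑ j ∈ Finset.range k, Real.exp (-ℓ) ^ (k - j) := by rw [Finset.mul_sum]
    _ ≤ 3 * S * (Real.exp (-ℓ) / (1 - Real.exp (-ℓ))) :=
        mul_le_mul_of_nonneg_left (geomTail_le hr0 hr1 k) (by positivity)
    _ ≤ 3 * S * (1 / ℓ) := mul_le_mul_of_nonneg_left (expTail_le hℓ) (by positivity)
    _ = 3 * S / ℓ := by ring

end Numbers

/-! ## 3. The metric half of the collar cover (pp. 267–268 rule, maximal reading) -/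

section Cover

/-- SCHEMATIC carrier for the chain argument behind the volume count: `Pt` = points of T_η with ONE pseudometric `d`
(triangle inequality only); `Ω j` = Ω_j with the convention `Ω 0 = T_η` of (42) p. 266 [12] (*"where we have put
Λ₀ = Ω₁ᶜ"*); `P j` = the points covered by the large-field plaquettes of the decomposition made at the passage j → j+1;
`w j` = the collar width of the rule at scale j measured by `d` (i.e. `(R(g_j)M₁ + block granularity)·Lʲη`, (39) p. 266 and
p. 268 [14] *"a union of big blocks of the lattice T₁⁽ᵏ⁾, with distances to P ∪ Ω_k⁽ᵏ⁾ᶜ greater than R(g_k)M₁"*); `ruleMax`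
= the MAXIMAL reading of the rule (gen 2's `B10LargeField.Rule268Max`, here over `d`): a point w_j-far from P_j ∪ Ω_jᶜ
belongs to Ω_{j+1}.  (p. 258 [4] (8): *"partial resummation over all P determining the same domain Ω₁"* presupposes that P
determines Ω₁, i.e. a definite rule.)  Only NAMES the printed objects; cell DIVERGENCE D-b10.7. [cite: Balaban1985UV3, pp.267–268; (39) p.266; (8) p.258] -/
structure CollarChain where
  Pt : Type
  d : Pt → Pt → ℝ
  d_triangle : ∀ x y z, d x z ≤ d x y + d y z
  Ω : ℕ → Set Pt
  P : ℕ → Set Pt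
  w : ℕ → ℝ
  Ω_zero : ∀ x, x ∈ Ω 0
  ruleMax : ∀ (j : ℕ) (y : Pt), (∀ x : Pt, (x ∈ P j ∨ x ∉ Ω j) → w j < d x y) → y ∈ Ω (j + 1)

/-- **Cover chain.**  Under the maximal rule every point of `Z_j = Ω_{j+1}ᶜ` lies within the accumulated collar widths
`Σ_{m=i}^{j} w_m` of a point of some `P_i`, `i ≤ j`: Z_j is COVERED by the collars of the large-field plaquettes of the
scales ≤ j (induction on j with the triangle inequality; at j = 0, Ω₀ = T_η leaves only P₀).  With
`w_m ≍ R(g_m)M₁Lᵐη` decreasing in R along the flow, `Σ_{m=i}^{j} w_m ≤ (R(g_i) + O(1))M₁Lʲη·L/(L − 1)` — O(1) collar widths at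
scale j per source, whence the counted form `ZvolCover` below (cell GAPS G-adv2-7: *"the neighbourhoods accumulate to
≤ RM₁L/(L−1) in scale-j units"*). [cite: Balaban1985UV3, pp.267–268; (39) p.266] -/
theorem cover_chain (C : CollarChain) (j : ℕ) (y : C.Pt) (hy : y ∉ C.Ω (j + 1)) :
    ∃ i, i ≤ j ∧ ∃ x, x ∈ C.P i ∧ C.d x y ≤ ∑ m ∈ Finset.Icc i j, C.w m := by
  induction j generalizing y with
  | zero =>
    have h := mt (C.ruleMax 0 y) hy
    push Not at h
    obtain ⟨x, hx, hd⟩ := h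
    rcases hx with hx | hx
    · exact ⟨0, le_rfl, x, hx, by simpa using hd⟩
    · exact absurd (C.Ω_zero x) hx
  | succ j ih =>
    have h := mt (C.ruleMax (j + 1) y) hy
    push Not at h
    obtain ⟨x, hx, hd⟩ := h
    rcases hx with hx | hx
    · exact ⟨j + 1, le_rfl, x, hx, by simpa using hd⟩
    · obtain ⟨i, hi, x', hx', hd'⟩ := ih x hx
      refine ⟨i, Nat.le_succ_of_le hi, x', hx', ?_⟩
      rw [Finset.sum_Icc_succ_top (by omega : i ≤ j + 1)]
      linarith [C.d_triangle x' x y]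

end Cover

/-! ## 4. The refined history carrier over `B10.TowerRun` and the verbatim leaves -/

section Carrier

/-- REFINED CARRIER for the sum in **(41)** p. 266 [12] over gen 1's `B10.TowerRun` (whose `Hist k`, `LF k U F` only
name *"Σ_{{Ω_j}} ∫dV_{k−1}↾Z_{k−1} δ(V̄_{k−1}V⁻¹) ⋯ ∫dV₀↾Z₀ δ(V̄₀V₁⁻¹) χ_k ζ_{Λ_{k−1}} χ_{k−1} ⋯ ζ_{Λ₁}χ₁ζ_{Ω₁ᶜ} exp[…]"*).
It names the DISCRETE data of a history and the three facts the resummation uses: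
* `α` — labels of plaquettes (all scales); `E k` — the candidate (scale, plaquette) pairs `(j, p′)`, `j < k` (`E_lt`),
  p′ a plaquette of the Lʲη-lattice inside Ω_j⁽ʲ⁾, on which the decomposition of unity of the passage j → j+1 is made
  (p. 257 [3] (7) *"1 = Σ_P Π_{p∈P} χ({|U(∂p) − 1| ≥ ε₁}) Π_{p∈P^c} χ({|U(∂p) − 1| < ε₁}), (7) where the sum is over
  sets P of plaquettes of the lattice T."*; p. 267 [13] *"We introduce the decomposition of unity (7) for the field V
  on the domain Λ_k, with ε₁ = g_kp(g_k)"*, Λ_k = Ω_k⁽ᵏ⁾ at that point);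
  `card_E` — at most `3|T₁^{(j)}| = 3e^{σ(k−j)}|T₁^{(k)}|` of them per scale, `σ = 3 log L` (p. 256 [2], the display
  *"|T₁^{(k)}| = Σ_{y∈T₁^{(k)}} 1 = Σ_{x∈T_η} η³ = (Lᵏε)⁻³|T_ε|"* — the number of sites of T₁^{(k)}; three plaquettes
  per site);
* `disc k h ⊆ E k` — the large-field plaquettes `{(j, p′) : p′ ∈ P_j}` of the history h (p. 273 [19] *"a plaquette
  p′ ⊂ Λ_j and such that |V_j(∂p′) − 1| ≥ g_jp(g_j)"*); `Hist k` is read as the SUPPORT of the sum/integral (histories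
  with their fields in the supports of the characteristic functions), so that pointwise bounds "for all h" are bounds on
  the support;
* `zvol k j Q` — |Z_j| (p. 266: *"Here the sets Z_j are rescaled to the unit scale"*) of the discrete history Q at step k;
* `dominated` — how (41) is USED: if the exponent is bounded on every history by a function B of its discrete data, the
  functional is at most the sum over all discrete histories Q ⊆ E k of `e^{B(Q)}` times the MASS of the remaining
  constrained integrations `∫dV_j↾Z_j δ(V̄_jV_{j+1}⁻¹) ⋯ χ ⋯ ζ`, allowed to be `≤ exp(A₀ Σ_{j<k} |Z_j(Q)|)` (p. 268 [14]: the
  integral over Z_k *"defines the first expression (48) in the inductive formula for k+1"* — it is carried, never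
  estimated, in print; A₀ ≥ 0 names its rate; cell GAPS G-B10-10(c)).  Histories that do not occur contribute
  nonnegative terms, so summing over the whole powerset only weakens the hypothesis.
No construction is asserted; an instance built from the true integrals is exactly what the leaves below are about.
[cite: Balaban1985UV3, (41) p.266; (7) p.257; (8) p.258; pp.267–268; p.256] -/
structure HistModel (T : B10.TowerRun) where
  α : Type
  E : ℕ → Finset (ℕ × α)
  E_lt : ∀ k, ∀ e ∈ E k, e.1 < k
  σ : ℝ
  card_E : ∀ k j, j < k →
    (((E k).filter (fun e => e.1 = j)).card : ℝ) ≤ 3 * Real.exp (σ * ((k - j : ℕ) : ℝ)) * T.sites k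
  disc : (k : ℕ) → T.Hist k → Finset (ℕ × α)
  disc_sub : ∀ k h, disc k h ⊆ E k
  zvol : ℕ → ℕ → Finset (ℕ × α) → ℝ
  A₀ : ℝ
  A₀_nonneg : 0 ≤ A₀
  dominated : ∀ k, k ≤ T.K → ∀ (U : T.Cfg k) (F : T.Hist k → ℝ) (B : Finset (ℕ × α) → ℝ),
    (∀ h, F h ≤ B (disc k h)) →
      T.LF k U F ≤ ∑ Q ∈ (E k).powerset, Real.exp (B Q + A₀ * ∑ j ∈ Finset.range k, zvol k j Q)

variable {T : B10.TowerRun}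

/-- **(67)–(71) for all large-field plaquettes**, p. 273 [19], verbatim: *"Let us take a plaquette p′ ⊂ Λ_j and such that
|V_j(∂p′) − 1| ≥ g_jp(g_j). … This inequality can be written finally as
(1/g_k²) Σ_{p⊂Δ′} η⁻¹[1 − Re tr U_k(∂p)] ≥ (1/2g_j²)|V_j(∂p′) − 1|² − O(1)g_jp³(g_j) ≥ ½p²(g_j) − O(1)g_jp³(g_j) ≥ ¼p²(g_j)
(71) for g_j sufficiently small. … We get these small factors for all plaquettes in all large fields set P."*
(Δ′ = B^j(x₀) ∪ B^j(y₀) ∪ B^j(z₀) ∪ B^j(w₀), the blocks at the corners of p′, p. 273.)  Typed as what the resummation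
consumes: on every history of step k ≤ K the main action `(1/g_k²)A^η(U_k)` (`mainT`, a sum of the NONNEGATIVE
plaquette terms η⁻¹[1 − Re tr U_k(∂p)]) dominates `c₁ · Σ_{(j,p′) ∈ P} ¼p²(g_j)`, provided all couplings of the run are
`≤ g̃` ("g_j sufficiently small").  Print takes the regions Δ′(p′) of distinct p′ as disjoint (c₁ = 1); they overlap with
bounded multiplicity (≤ 12 per scale, and by (39) only among ≤ 3 adjacent scales), so some absolute `c₁ ∈ (0, 1]` is what
(71) yields for ALL p′ simultaneously — cell GAPS G-B10-10(a).  A hypothesis, never asserted. [cite: Balaban1985UV3, (67)–(71) p.273] -/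
def SmallFactorsAll (X : HistModel T) (c₁ gs : ℝ) : Prop :=
  (∀ j, j ≤ T.K → 0 < T.g j ∧ T.g j ≤ gs) →
    ∀ k, k ≤ T.K → ∀ (U : T.Cfg k) (h : T.Hist k),
      c₁ * ∑ e ∈ X.disc k h, B10.pFun T.b₀ T.p₀ (T.g e.1) ^ 2 / 4 ≤ T.mainT k h U

/-- **The volume terms of (41)/(66)**, p. 266 [12] / p. 273 [19], verbatim: *"+ Σ_{j=0}^{k−1} O(log g_j⁻¹)|Z_j|"* — with the
O-constant named: `O(log g_j⁻¹) ≤ A·(1 + log g_j⁻¹) = A·x(g_j)` and |Z_j| the volume of the history's Z_j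
(`HistModel.zvol`).  A hypothesis (it binds gen 1's abstract `TowerRun.Zterm` to the refined carrier), never asserted.
[cite: Balaban1985UV3, (41) p.266, (66) p.273] -/
def ZtermRate (X : HistModel T) (A : ℝ) : Prop :=
  ∀ k, k ≤ T.K → ∀ h : T.Hist k,
    T.Zterm k h ≤ ∑ j ∈ Finset.range k, A * xlog (T.g j) * X.zvol k j (X.disc k h)

/-- **Counted collar cover** (pp. 267–268 [13–14] rule + (39) p. 266 [12], verbatim: *"(Lʲη)⁻¹dist(Ω_jᶜ, Ω_{j+1}) >
R(g_j)M₁, R(g_j) = R₁r(g_j), (39)  Ω_j is a union of big blocks of the size M₁Lʲη"*; p. 268: *"Z_k = B(Λ_{k+1})ᶜ"*): the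
volume |Z_j| of a history, in Lʲη-units, is at most the sum over its large-field plaquettes (i, p′) with i ≤ j of
`(c_g·ρ·x(g_i)^{r₀})³`, ρ = R₁M₁, c_g a geometric constant (block granularity and the factor L/(L − 1) of the accumulated
widths).  Its set-theoretic half is `cover_chain`; the count of Lʲη-lattice points in a ball is not modelled (cell
DIVERGENCE D-b10.7).  A hypothesis, never asserted. [cite: Balaban1985UV3, (39) p.266, pp.267–268] -/
def ZvolCover (X : HistModel T) (cg ρ r₀ : ℝ) : Prop :=
  ∀ k, k ≤ T.K → ∀ Q, Q ⊆ X.E k → ∀ j, j < k →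
    X.zvol k j Q ≤ ∑ e ∈ Q.filter (fun e => e.1 ≤ j), (cg * ρ) ^ 3 * xlog (T.g e.1) ^ (3 * r₀)

/-- Counting the candidates scale by scale: for `φ ≥ 0`, `Σ_{(j,p′) ∈ E k} φ(j) ≤ Σ_{j<k} 3e^{σ(k−j)}|T₁^{(k)}|·φ(j)`.
[cite: Balaban1985UV3, p.256] -/
theorem sum_candidates_le (X : HistModel T) (k : ℕ) (φ : ℕ → ℝ) (hφ : ∀ j, 0 ≤ φ j) :
    ∑ e ∈ X.E k, φ e.1
      ≤ ∑ j ∈ Finset.range k, 3 * Real.exp (X.σ * ((k - j : ℕ) : ℝ)) * T.sites k * φ j := by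
  have hmaps : ∀ e ∈ X.E k, e.1 ∈ Finset.range k := fun e he => Finset.mem_range.mpr (X.E_lt k e he)
  rw [← Finset.sum_fiberwise_of_maps_to' hmaps]
  refine Finset.sum_le_sum fun j hj => ?_
  rw [Finset.sum_const, nsmul_eq_mul]
  exact mul_le_mul_of_nonneg_right (X.card_E k j (Finset.mem_range.mp hj)) (hφ j)

end Carrier

/-! ## 5. The sum over large-field histories is controlled -/

section Main

variable {T : B10.TowerRun}

/-- **MAIN (kernel): the located gap G-B10-02 closed modulo the verbatim leaves.**  Let a run `T` carry a refined
history model `X` with the three leaves — small factors for all large-field plaquettes with overlap constant `c₁ ≥ 0`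
in the regime `g_j ≤ g̃ ≤ 1` ((67)–(71) p. 273), the rate `A` of the volume terms ((41)/(66)), the counted collar cover
with constants `c_g, ρ = R₁M₁, r₀` (pp. 267–268, (39)) — and let the couplings follow B10's progression
`x(g_j) = x_K + (K − j)ℓ` (ℓ = ½ log L; `B10LargeField.xlog_gRun`).  IF `3r₀ + 2 ≤ 2p₀`, `8(A + A₀)(c_gρ)³/ℓ ≤ c₁b₀²` and
`8(σ + ℓ) ≤ c₁b₀²ℓ`, THEN gen 1's leaf holds: `B10.LargeFieldControlPrinted T` with `d = 3/ℓ`.  Proof = domination by the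
sum over discrete histories, per-source net exponent `≤ −(c₁/8)p²(g_i)` (`perSource_net_le`), resummation
`Σ_{Q⊆E}Π ≤ exp Σ` (`sum_powerset_exp_sum_le`), scale entropy (`scaleEntropy_sum_le`).  This is the sentence of pp. 273–274
[19–20] *"The analysis of Sect. 3.C [9], which is model independent, show that these small factors are enough to control all
sums in (41), together with the second term in (65) ⟦(66)⟧. This gives the upper bound in (5)."* carried out in B10's own
variables; the exponent proviso is the cell's objection G-adv2-7 / G-B10-02 (print: "p₀ > 2", r₀ free), the b₀-provisos
read p. 257 *"b₀ is a sufficiently large absolute constant"* (G-B10-10(d)).  Re-derived bookkeeping; value = located gap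
closed modulo leaves, NOT summit progress. [cite: Balaban1985UV3, pp.273–274, (41) p.266, (7) p.257, (5) p.256] -/
theorem largeFieldControl_of_resummation (X : HistModel T) {A c₁ gs cg ρ r₀ ℓ xK : ℝ}
    (hSF : SmallFactorsAll X c₁ gs) (hZ : ZtermRate X A) (hV : ZvolCover X cg ρ r₀)
    (hA : 0 ≤ A) (hc₁ : 0 ≤ c₁) (hcg : 0 ≤ cg * ρ) (hr : 0 ≤ r₀) (hℓ : 0 < ℓ)
    (hg : ∀ j, j ≤ T.K → 0 < T.g j ∧ T.g j ≤ gs) (hgs : gs ≤ 1)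
    (hx : ∀ j, j ≤ T.K → xlog (T.g j) = xK + ((T.K - j : ℕ) : ℝ) * ℓ)
    (hp : r₀ * 3 + 2 ≤ 2 * T.p₀)
    (hb₁ : 8 * ((A + X.A₀) * (cg * ρ) ^ 3 / ℓ) ≤ c₁ * T.b₀ ^ 2)
    (hb₂ : 8 * (X.σ + ℓ) ≤ c₁ * T.b₀ ^ 2 * ℓ) :
    B10.LargeFieldControlPrinted T := by
  refine ⟨3 / ℓ, by positivity, fun k hk U => ?_⟩
  -- the unit x_j = 1 + log g_j⁻¹ along the run
  set x : ℕ → ℝ := fun j => xlog (T.g j) with hxdef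
  have hx1 : ∀ j, j ≤ T.K → 1 ≤ x j := fun j hj => one_le_xlog (hg j hj).1 ((hg j hj).2.trans hgs)
  have hxmono : ∀ i j, i ≤ j → j ≤ T.K → x j ≤ x i := by
    intro i j hij hj
    show xlog (T.g j) ≤ xlog (T.g i)
    rw [hx i (hij.trans hj), hx j hj]
    have : ((T.K - j : ℕ) : ℝ) ≤ ((T.K - i : ℕ) : ℝ) := by exact_mod_cast Nat.sub_le_sub_left hij _
    nlinarith
  have hxdiff : ∀ i, i ≤ k → x i - x k = ((k - i : ℕ) : ℝ) * ℓ := by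
    intro i hi
    show xlog (T.g i) - xlog (T.g k) = ((k - i : ℕ) : ℝ) * ℓ
    rw [hx i (hi.trans hk), hx k hk]
    have hcast : ((T.K - i : ℕ) : ℝ) = ((T.K - k : ℕ) : ℝ) + ((k - i : ℕ) : ℝ) := by
      rw [← Nat.cast_add]
      congr 1
      omega
    rw [hcast]
    ring
  have hp1 : 1 ≤ 2 * T.p₀ := by linarith
  have hκ : 0 ≤ c₁ * T.b₀ ^ 2 / 8 := by positivity
  -- per-source data: collar volume, accumulated rates, gain
  let V : ℕ × X.α → ℝ := fun e => (cg * ρ) ^ 3 * x e.1 ^ (3 * r₀)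
  let S : ℕ × X.α → ℝ := fun e => ∑ j ∈ (Finset.range k).filter (fun j => e.1 ≤ j), (A * x j + X.A₀)
  let gain : ℕ × X.α → ℝ := fun e => c₁ * (T.b₀ * x e.1 ^ T.p₀) ^ 2 / 4
  let θ : ℕ × X.α → ℝ := fun e => -(c₁ * (T.b₀ * x e.1 ^ T.p₀) ^ 2 / 8)
  -- the bounding function of the discrete data
  let B : Finset (ℕ × X.α) → ℝ := fun Q =>
    -(∑ e ∈ Q, gain e) + ∑ j ∈ Finset.range k, A * x j * X.zvol k j Q
  have hFB : ∀ h, -(T.mainT k h U) + T.Zterm k h ≤ B (X.disc k h) := by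
    intro h
    have h1 := hSF hg k hk U h
    have h2 := hZ k hk h
    have h3 : c₁ * ∑ e ∈ X.disc k h, B10.pFun T.b₀ T.p₀ (T.g e.1) ^ 2 / 4 = ∑ e ∈ X.disc k h, gain e := by
      rw [Finset.mul_sum]
      refine Finset.sum_congr rfl fun e _ => ?_
      simp only [gain, pFun_eq, hxdef]
      ring
    show -(T.mainT k h U) + T.Zterm k h
        ≤ -(∑ e ∈ X.disc k h, gain e) + ∑ j ∈ Finset.range k, A * x j * X.zvol k j (X.disc k h)
    linarith
  have hdom := X.dominated k hk U (fun h => -(T.mainT k h U) + T.Zterm k h) B hFB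
  -- each history's exponent is at most the sum of the surviving (halved) small factors of its plaquettes
  have hsummand : ∀ Q ∈ (X.E k).powerset,
      Real.exp (B Q + X.A₀ * ∑ j ∈ Finset.range k, X.zvol k j Q) ≤ Real.exp (∑ e ∈ Q, θ e) := by
    intro Q hQ
    rw [Finset.mem_powerset] at hQ
    apply Real.exp_le_exp.mpr
    have hz : ∀ j ∈ Finset.range k, (A * x j + X.A₀) * X.zvol k j Q
        ≤ (A * x j + X.A₀) * ∑ e ∈ Q.filter (fun e => e.1 ≤ j), V e := by
      intro j hj
      rw [Finset.mem_range] at hj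
      have hxj : 1 ≤ x j := hx1 j (by omega)
      have hrate : 0 ≤ A * x j + X.A₀ := by nlinarith [X.A₀_nonneg]
      exact mul_le_mul_of_nonneg_left (hV k hk Q hQ j hj) hrate
    have step1 : B Q + X.A₀ * ∑ j ∈ Finset.range k, X.zvol k j Q
        = -(∑ e ∈ Q, gain e) + ∑ j ∈ Finset.range k, (A * x j + X.A₀) * X.zvol k j Q := by
      show (-(∑ e ∈ Q, gain e) + ∑ j ∈ Finset.range k, A * x j * X.zvol k j Q)
          + X.A₀ * ∑ j ∈ Finset.range k, X.zvol k j Q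
          = -(∑ e ∈ Q, gain e) + ∑ j ∈ Finset.range k, (A * x j + X.A₀) * X.zvol k j Q
      rw [Finset.mul_sum, add_assoc, ← Finset.sum_add_distrib]
      congr 1
      refine Finset.sum_congr rfl fun j _ => ?_
      ring
    have step2 : ∑ j ∈ Finset.range k, (A * x j + X.A₀) * ∑ e ∈ Q.filter (fun e => e.1 ≤ j), V e
        = ∑ e ∈ Q, V e * S e := exchange_sum Q k (fun j => A * x j + X.A₀) V
    have step3 : ∀ e ∈ Q, -(gain e) + V e * S e ≤ θ e := by
      intro e he
      have heE : e ∈ X.E k := hQ he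
      have hik : e.1 < k := X.E_lt k e heE
      exact perSource_net_le (x := x) hA X.A₀_nonneg hcg hℓ hik
        (fun j hj => hx1 j (hj.trans hk)) (fun j hij hj => hxmono e.1 j hij (hj.trans hk))
        (hxdiff e.1 hik.le) hp hb₁
    calc B Q + X.A₀ * ∑ j ∈ Finset.range k, X.zvol k j Q
        = -(∑ e ∈ Q, gain e) + ∑ j ∈ Finset.range k, (A * x j + X.A₀) * X.zvol k j Q := step1
      _ ≤ -(∑ e ∈ Q, gain e) + ∑ j ∈ Finset.range k, (A * x j + X.A₀) * ∑ e ∈ Q.filter (fun e => e.1 ≤ j), V e :=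
          by linarith [Finset.sum_le_sum hz]
      _ = -(∑ e ∈ Q, gain e) + ∑ e ∈ Q, V e * S e := by rw [step2]
      _ = ∑ e ∈ Q, (-(gain e) + V e * S e) := by
          rw [Finset.sum_add_distrib, Finset.sum_neg_distrib]
      _ ≤ ∑ e ∈ Q, θ e := Finset.sum_le_sum step3
  -- the surviving factor at scale j is at most e^{−κ x_j}, κ = c₁b₀²/8
  have hθ : ∀ e ∈ X.E k, Real.exp (θ e) ≤ Real.exp (-(c₁ * T.b₀ ^ 2 / 8 * x e.1)) := by
    intro e he
    have hik : e.1 < k := X.E_lt k e he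
    have hxe : 1 ≤ x e.1 := hx1 e.1 (by omega)
    have hx0 : 0 ≤ x e.1 := by linarith
    apply Real.exp_le_exp.mpr
    have h2 : (x e.1 ^ T.p₀) ^ 2 = x e.1 ^ (2 * T.p₀) := by
      rw [mul_comm, Real.rpow_mul hx0, Real.rpow_two]
    have h3 : x e.1 ≤ x e.1 ^ (2 * T.p₀) := by
      have := Real.rpow_le_rpow_of_exponent_le hxe hp1
      rwa [Real.rpow_one] at this
    have h4 : c₁ * T.b₀ ^ 2 / 8 * x e.1 ≤ c₁ * T.b₀ ^ 2 / 8 * (x e.1 ^ T.p₀) ^ 2 := by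
      rw [h2]
      exact mul_le_mul_of_nonneg_left h3 hκ
    show -(c₁ * (T.b₀ * x e.1 ^ T.p₀) ^ 2 / 8) ≤ -(c₁ * T.b₀ ^ 2 / 8 * x e.1)
    rw [mul_pow]
    linarith
  have hxj : ∀ j, j < k → 1 + ((k - j : ℕ) : ℝ) * ℓ ≤ x j := by
    intro j hj
    have := hxdiff j hj.le
    have := hx1 k hk
    linarith
  have hκℓ : X.σ + ℓ ≤ c₁ * T.b₀ ^ 2 / 8 * ℓ := by linarith
  have hfinal : ∑ e ∈ X.E k, Real.exp (θ e) ≤ 3 / ℓ * T.sites k := by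
    calc ∑ e ∈ X.E k, Real.exp (θ e) ≤ ∑ e ∈ X.E k, Real.exp (-(c₁ * T.b₀ ^ 2 / 8 * x e.1)) :=
          Finset.sum_le_sum hθ
      _ ≤ ∑ j ∈ Finset.range k,
            3 * Real.exp (X.σ * ((k - j : ℕ) : ℝ)) * T.sites k * Real.exp (-(c₁ * T.b₀ ^ 2 / 8 * x j)) :=
          sum_candidates_le X k (fun j => Real.exp (-(c₁ * T.b₀ ^ 2 / 8 * x j))) fun j => (Real.exp_pos _).le
      _ ≤ 3 * T.sites k / ℓ :=
          scaleEntropy_sum_le x k hℓ (T.sites_nonneg k) hκ hκℓ hxj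
      _ = 3 / ℓ * T.sites k := by ring
  calc T.LF k U (fun h => -(T.mainT k h U) + T.Zterm k h)
      ≤ ∑ Q ∈ (X.E k).powerset, Real.exp (B Q + X.A₀ * ∑ j ∈ Finset.range k, X.zvol k j Q) := hdom
    _ ≤ ∑ Q ∈ (X.E k).powerset, Real.exp (∑ e ∈ Q, θ e) := Finset.sum_le_sum hsummand
    _ ≤ Real.exp (∑ e ∈ X.E k, Real.exp (θ e)) := sum_powerset_exp_sum_le _ θ
    _ ≤ Real.exp (3 / ℓ * T.sites k) := Real.exp_le_exp.mpr hfinal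

/-- **The same on the printed flow** `g_j = g(Lʲε)^{1/2}` (p. 256 [2]; `B10.gRun`), ℓ = ½ log L, σ = 3 log L: the
progression hypothesis is `B10LargeField.xlog_gRun`, and the scale condition becomes `c₁b₀² ≥ 56` (8(σ + ℓ) = 56ℓ).
With `c_g, R₁, M₁, A, A₀` fixed, both b₀-conditions are "b₀ sufficiently large" DEPENDING ON L, M₁, R₁ and the O(1) of
(41) — whose independence of b₀ the print does not state (p. 257 [3] *"b₀ is a sufficiently large absolute constant"*;
cell GAPS G-B10-10(d)); the alternative threshold form (ε₀(g) small, strict `3r₀ + 2 < 2p₀`) is gen 2's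
`perPlaquette_closes_threshold`. [cite: Balaban1985UV3, (5) p.256, (7) p.257, pp.273–274] -/
theorem largeFieldControl_of_resummation_gRun (X : HistModel T) {A c₁ gs cg ρ r₀ g L ε : ℝ}
    (hSF : SmallFactorsAll X c₁ gs) (hZ : ZtermRate X A) (hV : ZvolCover X cg ρ r₀)
    (hA : 0 ≤ A) (hc₁ : 0 ≤ c₁) (hcg : 0 ≤ cg * ρ) (hr : 0 ≤ r₀) (hg0 : 0 < g) (hL : 1 < L) (hε : 0 < ε)
    (hrun : ∀ j, T.g j = B10.gRun g L ε j)
    (hg : ∀ j, j ≤ T.K → 0 < T.g j ∧ T.g j ≤ gs) (hgs : gs ≤ 1)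
    (hσ : X.σ = 3 * Real.log L)
    (hp : r₀ * 3 + 2 ≤ 2 * T.p₀)
    (hb₁ : 8 * ((A + X.A₀) * (cg * ρ) ^ 3 / (Real.log L / 2)) ≤ c₁ * T.b₀ ^ 2)
    (hb₂ : 56 ≤ c₁ * T.b₀ ^ 2) :
    B10.LargeFieldControlPrinted T := by
  have hlog : 0 < Real.log L := Real.log_pos hL
  have hℓ : 0 < Real.log L / 2 := by positivity
  refine largeFieldControl_of_resummation X (xK := xlog (T.g T.K)) hSF hZ hV hA hc₁ hcg hr hℓ hg hgs ?_ hp hb₁ ?_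
  · intro j hj
    rw [hrun j, hrun T.K]
    exact xlog_gRun g L ε hg0 (by linarith) hε hj
  · rw [hσ]
    nlinarith

end Main

end Literature.MathematicalPhysics.QuantumFieldTheory.Balaban1983to89.B10LargeFieldSum
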